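import Literature.MathematicalPhysics.QuantumFieldTheory.Balaban1983to89.B6Ineq2134KFamKLevelExportV1
import Literature.MathematicalPhysics.QuantumFieldTheory.Balaban1983to89.B6Prop22SeriesMultiLevelBox

/-!
# `Balaban1983to89.B6Series2141KLevelV1` — T. Bałaban, *Propagators and renormalization transformations for lattice gauge theories. II*,
# Commun. Math. Phys. **96** (1984) 223–250 [Balaban1984PropagatorsII], Prop. 2.6 p. 247: THE CONVERGENCE SENTENCE «the series (2.141) is convergent in
# the norms appearing in the inequalities (2.136)–(2.140)» FOR THE ENTRY (2.136)₁ AT k LEVELS ON THE V1 TORUS — QUANTITATIVE FORM (remainders `G·R^N`)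

statement-level skeleton of published theorems with citation tags; proofs where landed; nothing here is a claim about the Yang–Mills mass gap

PDF held: `paper:balaban1984-cmp96-propagators-rt-ii` (journal page = PDF page + 222): p. 247 [PDF 25], re-read this session on the text layer (`p0025.txt`):
*"The operator G can be represented as G = G₀(I − R)⁻¹ = Σ_{n=0}^∞ G₀Rⁿ = Σ_ω h_{□₀}G_{□₀}h_{□₀}·K_{□₁,□₂}G_{□₂}h_{□₂}·…·K_{□_{2n−1},□_{2n}}G_{□_{2n}}h_{□_{2n}}, (2.141)
and the series above is convergent in the norms appearing in the inequalities (2.136)–(2.140)."*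

CITATION HEADER (lean-in-tree rule) — WHAT IS REPRODUCED.  Cell `pub-ymgap` (HOME `run/shared/lean/pub/pub-ymgap/`), seat `pub-ymgap-dag-n03-b` (g2 staged §1–§2,
g3 = prover-pub-ymgap-dag-n03-b-g3-0 completed and filed it, 2026-08-26; dag-lead PRE-WORD [WORDS-74] INBOX l.11030), Track-A DAG node N03 = [B6]: the SECOND of the
two located print-vs-typed deltas of the chair's discharge ruling R443 (ii) («Prop. 2.6's sentence "the series (2.141) is convergent in the norms (2.136)–(2.140)"
is NOT a typed clause»), typed for the norm of (2.136)₁.  IMPORTS BY NAME, restating nothing: p22's `…B6Ineq2134KFamKLevelExportV1.h2134_kFam_kLevel_unconditional`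
(the (2.134) family bound + its located smallness for the GENUINE cube members, no displayed analytic input), r03's `…B6Prop26KLevelSkeletonV1/V2` (`hB`, `zB`,
`ST`, `SbigT`, `outLoc_kFam_big`, `hNov_SbigT_of_QbigT`), `…B6CubeWindowV1` (the genuine members `Gl/Ml/Pl`, `hagree_cube`, `hinvl_cube`), `…B6CubeInDecayV1.hGin_cube`
((2.133) of the member), p38's `…B6CubeMoutV1.outLoc_Ml_hB'`, r03's `…B6Cover236QbigOverlapV1.card_filter_mem_QbigT_le` (`Nbig = 3·9^{d+1}`), p02's
`…B6Eq291Generator` (`gZero`, `rOp`, `kFam`, `eq291`), `…B6Prop26.fixedPoint_of_291`, `…B6RandomWalk.fixedPoint_telescope`, p21's `…B6Prop22SeriesMultiLevelBox.majorant_remainder_266W` (the generic tail of a fixed point),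
p21's `…B6Geom246MultiLevelTorus.lemma21_torus` (Lemma 2.1 on the torus).  NEAREST NEIGHBOURS (dedup): r03's `…B6Eq2141Expansion` is the ALGEBRA of (2.141) in a complete
normed ring under the HYPOTHESIS `‖R‖ < 1` — here the smallness is DISCHARGED at k levels and the convergence is in print's block-majorant norm; r03's
`…B6Line3CubeV1.prop26_2136_kLevel_unconditional` exports the (2.136)₁ majorant of `G` but not the walk; no `B6Prop26*KLevel*` file exports the remainders.

## WHAT THIS FILE CERTIFIES (kernel-checked, 0 sorry, standard axioms; THEOREMS ONLY — no `def`, no `def … : Prop`, no new named fact)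

§1 `series2141_of_2133_2134With₂` — the series twin of r03's `prop26_2136_of_2133_2134With₂` (SAME hypotheses), GENERIC over a geometry with two set
   families: (i) `G = G₀ + G·R`, (ii) (2.135), (iii) the `G₀` majorant, (iv) the remainders `G·R^N ≺ (N·A)c(N²θ₀c)^N(1 − N²θ₀c)⁻¹P(y)e^{−δ₃d}` for every `N`
   by p21's generic tail `…B6Prop22SeriesMultiLevelBox.majorant_remainder_266W` (imported, not restated).
§2 `series2141_kLevel_skeleton₂` — the series twin of r03's `prop26_2136_kLevel_skeleton₂` for the GENUINE `G = GE (domT hN D hk)` with ABSTRACT cube members under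
   (2.133)/(hagree)/(hinvl)/(hMout)/(2.134)/smallness, the rate `σ` as a parameter.
§3 **`series2141_kLevel_unconditional`** — NO DISPLAYED ANALYTIC HYPOTHESIS: the genuine members `Gl/Ml/Pl`, the exported (2.134) family, `Nbig = 3·9^{d+1}`; for the
   weight band there are `σ₁ > 0`, `C_G ≥ 0` such that for all `0 < σ ≤ σ₁`, `α ∈ [0,1]`, `N₀ ≥ 1` there is ONE threshold `M₂` with, on every admissible V1 torus,
   some `θ ≥ 0`, `θ·(2K) < 1` (`K = K261 N₀ (d+1) L 1 (ασ)`) and: (i) `G = G₀ + G·R`, (i′) `G = Σ_{n<N}G₀Rⁿ + G·R^N` for every `N`, (ii) `R ≺ θ·e^{−σd_T}` ((2.135)),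
   (iii) `G₀ ≺ (Nbig·C_G)·(L^{j(y)}/c′)²·e^{−σd_T}`, (iv) `G·R^N ≺ 2·(Nbig·C_G)·K·(½)^N·(L^{j(y)}/c′)²·e^{−delta3 α (2σ)·d_T}` for every `N` — the series (2.141)
   converges to `G` GEOMETRICALLY in the norm of (2.136)₁, uniformly in `k, M_h, m, K, c′`; `series2141_kLevel_remainder_L5` — the remainder clause at `L = 5`,
   `P′ ≥ 12` with the placement of the cubes DISCHARGED (`B6CubeWindowV1.placed_all_cubes`).

## HONEST SCOPE / DIVERGENCES

(1) The norm of (2.136)₁ ONLY: the sentence's other norms ((2.136)₂₋₄/(2.137) left factors — the same tail on p38's pair skeleton `B6Prop26PairKLevelAssemblyV1`;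
(2.138)/(2.139) — remainders `(∇G)(R^{N−1})(R∇*J)` on the Hölder class with this lineage's `B6Ineq2134DivNormSuppKLevelV1.divLegs_kLevel`; (2.140) — p22's `ℓ²`
bricks) are NOT claimed here.  (2) As the (2.136)₁ theorem of record: `L ≥ 5`, `M_h = Lᵃ ≥ 8`, `R ≥ 2L²`, `P′_μ ≥ 5`, `k ≥ 2`, cubes placed (discharged at `L = 5`,
`P′ ≥ 12`), the Lemma-2.1 budget `(α, N₀)` displayed (`N₀ + 1 ≤ R·L·M_h`, (2.59) at rate `σ`; for `α > 0` a consumer picks `N₀` as in r03's `_final_M`); constants on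
`d, L, b₀, b₁` (+ `α, N₀` through `K`), NOT on `k, M_h, m, K, c′`.  (3) This CLOSES a located print-vs-typed delta (R443 (ii), second item) for one norm; it is
NOT a new estimate, NOT a node discharge, count-neutral; `Node00/N03Record` untouched.  Integer torus, lattice units; nothing on d = 4 specifically or the
continuum; nothing ℝ⁴ / OS / mass-gap / Clay.

v1.1 (same seat, same day; v1.0 = p424631): §4 APPENDED (decls of v1.0 byte-identical) — `leftFactor_remainder_tail` (generic: `G = G₀ + G·R ⇒ DG = DG₀ + (DG)R`,
the tail by p21's `majorant_remainder_266W` at `G′ := DG`) and **`series2141_leftFactor_kLevel_unconditional`**: under the binders of `series2141_kLevel_unconditional`,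
for EVERY left factor `D`, constant `A′ ≥ 0` and weight `P′ ≥ 0`, if the per-cube first legs `D(h_□G_□h_□)` are majorised by `1_{□̃}(y)·A′P′(y)·e^{−σd_T}` (the
displayed hypothesis of p38's left-factor clause `…B6Prop26LeftEntryKLevelV1.prop26_pair_of_2133_2134With₂`), then `(DG)R^N ≺ 2(Nbig·A′)K(½)^N·P′(y)·e^{−δ₃d_T}`
for every `N` — the columns `Lʲη`, `·`, `1` of (2.136) and (2.137) of the same sentence, the first legs DISPLAYED (their producers are the per-entry leg files).
-/

open scoped BigOperators
open Finset

namespace Literature.MathematicalPhysics.QuantumFieldTheory.Balaban1983to89.B6Series2141KLevelV1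

open B6RandomWalk (HasMajorant hasMajorant_mono delta3 Triangle254 fixedPoint_telescope)
open B6Prop22SeriesMultiLevelBox (majorant_remainder_266W)
open B6Prop26Gluing (mulOp LocalMajorant OutLoc majorant_G0_of_2133 ineq2135_of_2134_291)
open B6Prop26 (fixedPoint_of_291)
open B6Lemma21Repaired (Ineq261With Ineq263With)
open B6Prop26KLevelSkeletonV2 (card_filter_mono SbigT mem_SbigT ST_subset_SbigT outLoc_kFam_big)
open B6MultiLevelBoxOperator (N0)
open B6MultiLevelTorusOperator (TDomains)
open B6Cover236MultiLevelBlocks (cubes)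
open B6Geom246MultiLevelTorus (geomT lemma21_torus triangle_refl_nonneg_T)
open B6Ineq261LevelGap (K261 K261_nonneg)
open B6Eq291Generator (kFam gZero rOp eq291)
open B6Ineq2133TwoScaleV1 (onFun)
open B6GlobalChartV1 (PV toBox domT blkV1)
open B6AgreeLapV1Chart (deltaAE_split)
open B6SectAOperatorsV1 (dE dsE dcE dcsE QE aE QsE RE BondIdx)
open B6SectAVectorModelV1 (deltaAE GE)
open B6Partition118KLevelTorusCentral (QT QbigT one_le_of_four_le)
open B6Prop26KLevelSkeletonV1 (hB zB ST mem_ST pref pref_nonneg sum_hB_sq abs_hB_le_one blkV1_mem_QT_of_hB_ne_zero mulOp_zB_mul_hB mulOp_hB_mul_zB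
  sum_mulOp_hB_sq onFun_GE_mul_deltaAE)
open B6Prop26KLevelSkeletonV2 (hNov_SbigT_of_QbigT)
open B6InMajorantTransplant (InMajorant inMajorant_mono InMajorant.localMajorant)
open B6CubeWindowV1 (Placed Gl Ml Pl GlobalBand hagree_cube hinvl_cube band_of_global band_le one_le_of_eight_le four_le_of_five_le)
open B6CubeInDecayV1 (hGin_cube)
open B6Ineq2134KFamKLevelExportV1 (h2134_kFam_kLevel_unconditional)
open B6Prop26KLevelAssemblyV1 (small_of_small_two)
open B6CubeMoutV1 (outLoc_Ml_hB')
open B6Cover236QbigOverlapV1 (card_filter_mem_QbigT_le)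

noncomputable section

/-! ## §1  The generic walk (2.141) with two set families: fixed point, (2.135), `G₀`, and the tail (p21's `majorant_remainder_266W`) -/

section Generic

variable {g : B6.Geometry} {X : Type}

open Classical in
/-- **THE WALK (2.141) WITH TWO SET FAMILIES — FIXED POINT, (2.135) AND THE TAIL** (the series twin of r03's
`B6Prop26KLevelSkeletonV2.prop26_2136_of_2133_2134With₂`, same hypotheses): boxes `𝒟` with sets `S_□ ⊆ U_□`, `U_□` of overlap number `N`; partition
functions `h_□`; box operators `G_□` with (2.133) on `S_□`; pair operators `K_{□,□′}G_{□′}` output-localised to `U_□` with (2.134) `θ₀e^{−½δ₂d}`;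
`G₀ = Σ h_□G_□h_□`, `R = Σ K_{□,□′}G_{□′}h_{□′}`, (2.91) `Δ_aG₀ = I − R`, `GΔ_a = I`.  THEN: (i) `G = G₀ + G·R` (so `G = Σ_{n<N′}G₀Rⁿ + G·R^{N′}`,
`B6RandomWalk.fixedPoint_telescope`); (ii) (2.135) `R ≺ N²θ₀·e^{−½δ₂d}`; (iii) `G₀ ≺ N·A·P·e^{−½δ₂d}`; (iv) under `N²θ₀c < 1`, for every `N′` the remainder
`G·R^{N′}` has the majorant `(N·A)·c·(N²θ₀c)^{N′}·(1 − N²θ₀c)⁻¹·P(y)·e^{−δ₃d}`, `δ₃ = delta3 α δ₂` — the series (2.141) converges geometrically in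
the norm of (2.136)₁. [cite: Balaban1984PropagatorsII, Prop. 2.6 (2.136), (2.141) p.247; (2.91)–(2.93) p.239; (2.133)–(2.135) p.247] -/
theorem series2141_of_2133_2134With₂ [Fintype X] [DecidableEq X] (blk : X → g.Site) (c δ₂ α θ₀ A : ℝ)
    (P : g.Site → ℝ) (hc : 0 ≤ c) (hA : 0 ≤ A) (hP : ∀ y, 0 ≤ P y) (hθ₀ : 0 ≤ θ₀) (hα : α ≤ 1) (hδ₂ : 0 ≤ δ₂)
    (htri : Triangle254 g) (hrefl : ∀ y : g.Site, g.dist y y = 0) (hdnn : ∀ y y' : g.Site, 0 ≤ g.dist y y')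
    (h261 : Ineq261With c g (δ₂ / 2) α) (h263 : Ineq263With c g (δ₂ / 2) α)
    {C : Type} (D : Finset C) (S U : C → Set g.Site) (hSU : ∀ i ∈ D, S i ⊆ U i) (N : ℕ)
    (hN : ∀ a : g.Site, (D.filter fun i => a ∈ U i).card ≤ N)
    (hsmall : (N : ℝ) ^ 2 * θ₀ * c < 1)
    (h : C → X → ℝ) (hsupp : ∀ i ∈ D, ∀ x, h i x ≠ 0 → blk x ∈ S i) (hle : ∀ i ∈ D, ∀ x, |h i x| ≤ 1)
    (Gl : C → Module.End ℝ (X → ℝ))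
    (h2133 : ∀ i ∈ D,
      LocalMajorant blk (Gl i) (S i) (fun a b => A * P a * Real.exp (-(δ₂ / 2 * g.dist a b))))
    (Kt : C → C → Module.End ℝ (X → ℝ))
    (h2134 : ∀ i ∈ D, ∀ i' ∈ D,
      HasMajorant blk (Kt i i' * mulOp (h i')) (fun a b => θ₀ * Real.exp (-(δ₂ / 2 * g.dist a b))))
    (hKout : ∀ i ∈ D, ∀ i' ∈ D, OutLoc blk (Kt i i') (U i))
    {G G0 R Δa : Module.End ℝ (X → ℝ)}
    (hG0 : G0 = ∑ i ∈ D, mulOp (h i) * Gl i * mulOp (h i))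
    (hR : R = ∑ i ∈ D, ∑ i' ∈ D, Kt i i' * mulOp (h i'))
    (hinv : G * Δa = 1) (h291 : Δa * G0 = 1 - R) :
    G = G0 + G * R ∧
    HasMajorant blk R (fun a b => (N : ℝ) ^ 2 * θ₀ * Real.exp (-(δ₂ / 2 * g.dist a b))) ∧
    HasMajorant blk G0 (fun a b => N * A * P a * Real.exp (-(δ₂ / 2 * g.dist a b))) ∧
    ∀ N' : ℕ, HasMajorant blk (G * R ^ N')
      (fun a b => (N * A) * c * ((N : ℝ) ^ 2 * θ₀ * c) ^ N' * (1 - (N : ℝ) ^ 2 * θ₀ * c)⁻¹ * P a *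
        Real.exp (-(delta3 α δ₂ * g.dist a b))) := by
  have hK : ∀ a b, 0 ≤ A * P a * Real.exp (-(δ₂ / 2 * g.dist a b)) := fun a b =>
    mul_nonneg (mul_nonneg hA (hP a)) (Real.exp_nonneg _)
  have hNS : ∀ a : g.Site, (D.filter fun i => a ∈ S i).card ≤ N := card_filter_mono D hSU hN
  have hG0m : HasMajorant blk G0 (fun a b => N * A * P a * Real.exp (-(δ₂ / 2 * g.dist a b))) := by
    rw [hG0]
    refine hasMajorant_mono blk (majorant_G0_of_2133 blk D S N hNS h hsupp hle Gl _ hK h2133) fun a b => le_of_eq ?_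
    ring
  have hsuppU : ∀ i ∈ D, ∀ x, h i x ≠ 0 → blk x ∈ U i := fun i hi x hx => hSU i hi (hsupp i hi x hx)
  have hRm : HasMajorant blk R (fun a b => (N : ℝ) ^ 2 * θ₀ * Real.exp (-(δ₂ / 2 * g.dist a b))) :=
    ineq2135_of_2134_291 blk D U N hN h hsuppU Kt δ₂ θ₀ hθ₀ h2134 hKout hR
  have hfix : G = G0 + G * R := fixedPoint_of_291 hinv h291
  have hαδ : 0 ≤ (1 - α) * (δ₂ / 2) := mul_nonneg (by linarith) (by linarith)
  refine ⟨hfix, hRm, hG0m, fun N' => ?_⟩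
  have h := majorant_remainder_266W blk c (δ₂ / 2) α ((N : ℝ) ^ 2 * θ₀) (N * A) P (mul_nonneg (Nat.cast_nonneg N) hA) hP
    (mul_nonneg (sq_nonneg _) hθ₀) hc hαδ htri hrefl hdnn h261 h263 hsmall hG0m hRm hfix N'
  refine hasMajorant_mono blk h fun a b => le_of_eq ?_
  simp only [delta3]

end Generic

/-! ## §2  The k-level skeleton: the genuine `G = Δ_a⁻¹` on the V1 torus, its (2.91) walk `G₀`, `R` from abstract cube members, and the tail -/

section Skeleton

variable {d ℓ : ℕ} {hd : 1 ≤ d + 1} {hL : Odd (ℓ + 1) ∧ 1 < ℓ + 1} {m K : ℕ} {Mh k R : ℕ} {P' : Fin (d + 1) → ℕ}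

open Classical in
/-- **THE SERIES (2.141) FOR THE GENUINE k-LEVEL `G`, SKELETON FORM** (the series twin of r03's `B6Prop26KLevelSkeletonV2.prop26_2136_kLevel_skeleton₂`, SAME
shape of hypotheses, the rate `σ` as a parameter: V1 torus `hN`, p21's family `D`, cubes with sets `□⁺ = ST ⊆ □̃ = SbigT` of overlap `Nov`, member
operators `G_□, M_□, P_□` with (2.133) on `□⁺` at rate `2σ/2`, (hagree), (hinvl), the genuine (2.91) kernels `K_{□,□′}G_{□′}h_{□′}` with (2.134)
`θ₀e^{−(2σ/2)d_T}` output-localised to `□̃`, Lemma 2.1's budget `(α, N₀)` with (2.59) at rate `σ`, and `Nov²θ₀K < 1`): with `G₀ := Σ_□ h_□G_□h_□` (`gZero`)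
and `R := Σ_{□,□′} K_{□,□′}G_{□′}h_{□′}` (`rOp`) — (i) `G = G₀ + G·R` for `G = GE (domT hN D hk)` (hence `G = Σ_{n<N}G₀Rⁿ + G·R^N`,
`B6RandomWalk.fixedPoint_telescope`); (ii) (2.135): `R ≺ Nov²θ₀·e^{−σd_T}`; (iii) `G₀ ≺ Nov·A·(L^{j(y)}/c′)²·e^{−σd_T}`; (iv) for every `N` the remainder
`G·R^N ≺ (Nov·A)·K·(Nov²θ₀K)^N·(1 − Nov²θ₀K)⁻¹·(L^{j(y)}/c′)²·e^{−δ₃d_T}`, `K = K261 N₀ (d+1) L 1 (ασ)`, `δ₃ = delta3 α (2σ)` — print's «the series (2.141)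
is convergent in the norm of (2.136)₁», quantitatively. [cite: Balaban1984PropagatorsII, Prop. 2.6 (2.136)₁, (2.141) p.247; (2.91)–(2.93) p.239; (2.133)–(2.135) p.247; Lemma 2.1 (2.59)–(2.63) p.234] -/
theorem series2141_kLevel_skeleton₂ (hN : ∀ μ, N0 ℓ Mh k P' μ = (PV d ℓ m K hd hL).sitesPerDir 0) (D : TDomains d ℓ Mh k P' R) (hk : k ≤ m + K)
    (hMh : 2 ≤ Mh) (hR : 2 * (ℓ + 1) ≤ R) (hP5 : ∀ μ, 5 ≤ P' μ)
    {σ A : ℝ} (hσ : 0 < σ) (hA : 0 ≤ A)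
    (α : ℝ) (hα0 : 0 ≤ α) (hα1 : α ≤ 1) (N₀ : ℕ) (hN₀ : 0 < N₀) (hRM : N₀ + 1 ≤ R * ((ℓ + 1) * Mh))
    (hθ : Real.exp (-(α * σ)) * ((ℓ : ℝ) + 1) ^ ((2 * (d + 1 : ℕ) : ℝ) / N₀) < 1)
    {cf : ℝ} (hcf : cf ≠ 0) {w : BondIdx (domT hN D hk) → ℝ} (hw : ∀ i, 0 < w i)
    (Nov : ℕ) (hNov : ∀ a : (geomT D).Site, (Finset.univ.filter fun c : ↥(cubes D.toDomains) =>
      a ∈ SbigT D (le_trans one_le_two hMh) (fun μ => le_trans (by norm_num) (hP5 μ)) c).card ≤ Nov)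
    (Gl Ml Pl : ↥(cubes D.toDomains) → Module.End ℝ (PBond (PV d ℓ m K hd hL) 0 → ℝ))
    (h2133 : ∀ c, LocalMajorant (g := geomT D) (blkV1 hN D) (Gl c)
      (ST D (le_trans one_le_two hMh) (fun μ => le_trans (by norm_num) (hP5 μ)) c)
      (fun a b => A * pref cf a * Real.exp (-((2 * σ) / 2 * (geomT D).dist a b))))
    (hagree : ∀ c, onFun (dcsE (P := PV d ℓ m K hd hL) cf ∘ₗ dcE cf + dE cf ∘ₗ dsE cf +
        QsE (domT hN D hk) ∘ₗ aE (domT hN D hk) w ∘ₗ QE (domT hN D hk)) * mulOp (hB hN D c) = Ml c * mulOp (hB hN D c))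
    (hinvl : ∀ c, (Ml c - Pl c) * Gl c * mulOp (hB hN D c) = mulOp (hB hN D c))
    (hMout : ∀ c, OutLoc (g := geomT D) (blkV1 hN D) (Ml c * mulOp (hB hN D c))
      (SbigT D (le_trans one_le_two hMh) (fun μ => le_trans (by norm_num) (hP5 μ)) c))
    (θ₀ : ℝ) (hθ₀ : 0 ≤ θ₀)
    (h2134 : ∀ c c', HasMajorant (g := geomT D) (blkV1 hN D)
      ((kFam (onFun (dE (P := PV d ℓ m K hd hL) cf ∘ₗ (LinearMap.id - RE (domT hN D hk) cf) ∘ₗ dsE cf))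
          (fun c => mulOp (hB hN D c)) (fun c => mulOp (zB hN D (le_trans one_le_two hMh) (fun μ => le_trans (by norm_num) (hP5 μ)) c))
          Ml Pl c c' * Gl c') * mulOp (hB hN D c'))
      (fun a b => θ₀ * Real.exp (-((2 * σ) / 2 * (geomT D).dist a b))))
    (hsmall : (Nov : ℝ) ^ 2 * θ₀ * K261 N₀ (d + 1) ((ℓ : ℝ) + 1) 1 (α * σ) < 1) :
    onFun (GE (domT hN D hk) hcf hw) =
        gZero Finset.univ (fun c => mulOp (hB hN D c)) Gl +
          onFun (GE (domT hN D hk) hcf hw) *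
            rOp Finset.univ (onFun (dE (P := PV d ℓ m K hd hL) cf ∘ₗ (LinearMap.id - RE (domT hN D hk) cf) ∘ₗ dsE cf))
              (fun c => mulOp (hB hN D c)) (fun c => mulOp (zB hN D (le_trans one_le_two hMh) (fun μ => le_trans (by norm_num) (hP5 μ)) c)) Gl Ml Pl ∧
    HasMajorant (g := geomT D) (blkV1 hN D)
      (rOp Finset.univ (onFun (dE (P := PV d ℓ m K hd hL) cf ∘ₗ (LinearMap.id - RE (domT hN D hk) cf) ∘ₗ dsE cf))
        (fun c => mulOp (hB hN D c)) (fun c => mulOp (zB hN D (le_trans one_le_two hMh) (fun μ => le_trans (by norm_num) (hP5 μ)) c)) Gl Ml Pl)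
      (fun a b => (Nov : ℝ) ^ 2 * θ₀ * Real.exp (-(σ * (geomT D).dist a b))) ∧
    HasMajorant (g := geomT D) (blkV1 hN D) (gZero Finset.univ (fun c => mulOp (hB hN D c)) Gl)
      (fun a b => Nov * A * pref cf a * Real.exp (-(σ * (geomT D).dist a b))) ∧
    ∀ N' : ℕ, HasMajorant (g := geomT D) (blkV1 hN D)
      (onFun (GE (domT hN D hk) hcf hw) *
        rOp Finset.univ (onFun (dE (P := PV d ℓ m K hd hL) cf ∘ₗ (LinearMap.id - RE (domT hN D hk) cf) ∘ₗ dsE cf))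
          (fun c => mulOp (hB hN D c)) (fun c => mulOp (zB hN D (le_trans one_le_two hMh) (fun μ => le_trans (by norm_num) (hP5 μ)) c)) Gl Ml Pl ^ N')
      (fun a b => (Nov * A) * K261 N₀ (d + 1) ((ℓ : ℝ) + 1) 1 (α * σ) *
        ((Nov : ℝ) ^ 2 * θ₀ * K261 N₀ (d + 1) ((ℓ : ℝ) + 1) 1 (α * σ)) ^ N' *
        (1 - (Nov : ℝ) ^ 2 * θ₀ * K261 N₀ (d + 1) ((ℓ : ℝ) + 1) 1 (α * σ))⁻¹ * pref cf a *
        Real.exp (-(delta3 α (2 * σ) * (geomT D).dist a b))) := by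
  classical
  have hMh1 : 1 ≤ Mh := le_trans one_le_two hMh
  have hP4 : ∀ μ, 4 ≤ P' μ := fun μ => le_trans (by norm_num) (hP5 μ)
  have hP : ∀ μ, 1 ≤ P' μ := one_le_of_four_le hP4
  obtain ⟨_, h261, _, h263⟩ := lemma21_torus D hMh1 hP hN₀ hRM hσ.le hα0 hα1 hθ
  obtain ⟨htri, hrefl, hdnn⟩ := triangle_refl_nonneg_T D hMh1 hP
  have hc : 0 ≤ K261 N₀ (d + 1) ((ℓ : ℝ) + 1) 1 (α * σ) := K261_nonneg (by positivity) zero_le_one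
  have hδ2 : (0 : ℝ) ≤ 2 * σ := by positivity
  have hhalf : 2 * σ / 2 = σ := by ring
  have hle : ∀ c ∈ (Finset.univ : Finset ↥(cubes D.toDomains)), ∀ b, |hB hN D c b| ≤ 1 := fun c _ b => abs_hB_le_one hN D hMh1 hP c b
  have hsupp : ∀ c ∈ (Finset.univ : Finset ↥(cubes D.toDomains)), ∀ b, hB hN D c b ≠ 0 →
      blkV1 hN D b ∈ ST D hMh1 hP4 c := fun c _ b hb => blkV1_mem_QT_of_hB_ne_zero hN D hMh hR hP4 c hb
  have hKout := outLoc_kFam_big hN D hMh hR hMh1 hP4 (onFun (dE (P := PV d ℓ m K hd hL) cf ∘ₗ (LinearMap.id - RE (domT hN D hk) cf) ∘ₗ dsE cf))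
    Gl Ml Pl hMout
  have h291 : onFun (deltaAE (domT hN D hk) cf w) * gZero Finset.univ (fun c => mulOp (hB hN D c)) Gl =
      1 - rOp Finset.univ (onFun (dE (P := PV d ℓ m K hd hL) cf ∘ₗ (LinearMap.id - RE (domT hN D hk) cf) ∘ₗ dsE cf))
        (fun c => mulOp (hB hN D c)) (fun c => mulOp (zB hN D hMh1 hP4 c)) Gl Ml Pl := by
    rw [deltaAE_split]
    exact eq291 Finset.univ _ _ (fun c => mulOp (hB hN D c)) (fun c => mulOp (zB hN D hMh1 hP4 c)) Gl Ml Pl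
      (sum_mulOp_hB_sq hN D hMh1 hP) (fun c _ => hagree c) (fun c _ => hinvl c)
      (fun c _ => mulOp_zB_mul_hB hN D hMh hR hP4 c) (fun c _ => mulOp_hB_mul_zB hN D hMh hR hP4 c)
  have hinv := onFun_GE_mul_deltaAE (domT hN D hk) hcf hw
  obtain ⟨hfix, hRm, hG0m, htail⟩ := series2141_of_2133_2134With₂ (g := geomT D) (blkV1 hN D)
    (K261 N₀ (d + 1) ((ℓ : ℝ) + 1) 1 (α * σ))
    (2 * σ) α θ₀ A (pref cf) hc hA (pref_nonneg cf) hθ₀ hα1 hδ2 htri hrefl hdnn (by rw [hhalf]; exact h261) (by rw [hhalf]; exact h263)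
    Finset.univ (fun c => ST D hMh1 hP4 c) (fun c => SbigT D hMh1 hP4 c) (fun c _ => ST_subset_SbigT D hMh1 hP4 c)
    Nov hNov hsmall (hB hN D) hsupp hle Gl (fun c _ => h2133 c)
    (fun c c' => kFam (onFun (dE (P := PV d ℓ m K hd hL) cf ∘ₗ (LinearMap.id - RE (domT hN D hk) cf) ∘ₗ dsE cf))
      (fun c => mulOp (hB hN D c)) (fun c => mulOp (zB hN D hMh1 hP4 c)) Ml Pl c c' * Gl c')
    (fun c _ c' _ => h2134 c c') (fun c _ c' _ => hKout c c') (G0 := gZero Finset.univ (fun c => mulOp (hB hN D c)) Gl)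
    (R := rOp Finset.univ (onFun (dE (P := PV d ℓ m K hd hL) cf ∘ₗ (LinearMap.id - RE (domT hN D hk) cf) ∘ₗ dsE cf))
      (fun c => mulOp (hB hN D c)) (fun c => mulOp (zB hN D hMh1 hP4 c)) Gl Ml Pl) rfl rfl hinv h291
  refine ⟨hfix, ?_, ?_, htail⟩
  · refine hasMajorant_mono (g := geomT D) (blkV1 hN D) hRm fun a b => le_of_eq ?_
    rw [hhalf]
  · refine hasMajorant_mono (g := geomT D) (blkV1 hN D) hG0m fun a b => le_of_eq ?_
    rw [hhalf]

end Skeleton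

/-! ## §3  NO DISPLAYED ANALYTIC INPUT: the genuine cube members, the exported (2.134) family, one size threshold -/

section Unconditional

variable {d ℓ : ℕ} {hd : 1 ≤ d + 1} {hL : Odd (ℓ + 1) ∧ 1 < ℓ + 1} {m K : ℕ} {Mh k R : ℕ} {P' : Fin (d + 1) → ℕ}

/-- rate weakening of an exponential kernel. [folklore] -/
private theorem exp_le_exp_of_rate {ρ σ t : ℝ} (h : σ ≤ ρ) (ht : 0 ≤ t) : Real.exp (-(ρ * t)) ≤ Real.exp (-(σ * t)) :=
  Real.exp_le_exp.mpr (neg_le_neg (mul_le_mul_of_nonneg_right h ht))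

/-- `q^N (1 − q)⁻¹ ≤ 2·(1/2)^N` for `0 ≤ q` with `2q < 1`. [folklore] -/
private theorem geom_tail_le {q : ℝ} (hq : 0 ≤ q) (h2 : q * 2 < 1) (N : ℕ) : q ^ N * (1 - q)⁻¹ ≤ 2 * (1 / 2) ^ N := by
  have hq1 : q ≤ 1 / 2 := by linarith
  have h1 : q ^ N ≤ (1 / 2) ^ N := pow_le_pow_left₀ hq hq1 N
  have h2 : (1 - q)⁻¹ ≤ 2 := by
    rw [inv_le_comm₀ (by linarith) (by norm_num)]
    linarith
  calc q ^ N * (1 - q)⁻¹ ≤ (1 / 2) ^ N * 2 := mul_le_mul h1 h2 (inv_nonneg.2 (by linarith)) (pow_nonneg (by norm_num) N)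
    _ = 2 * (1 / 2) ^ N := mul_comm _ _

open Classical in
/-- **PROPOSITION 2.6, THE CONVERGENCE SENTENCE OF (2.141) AS A TYPED k-LEVEL CLAUSE — NO DISPLAYED ANALYTIC HYPOTHESIS.**  For the GENUINE k-level
`G = GE (domT hN D hk)` of the V1 torus and the GENUINE cube members `G_□ = Gl`, `M_□ = Ml`, `P_□ = Pl` (r03's torus window of each cube), with
`G₀ = Σ_□ h_□G_□h_□` (`gZero`) and `R = Σ_{□,□′} K_{□,□′}G_{□′}h_{□′}` (`rOp`, the (2.92)–(2.93) kernels `kFam`): for the weight band `[b₀, b₁]` there are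
`σ₁ > 0` and `C_G ≥ 0` such that for all `0 < σ ≤ σ₁`, `α ∈ [0,1]`, `N₀ ≥ 1` there is `M₂ > 0` with — on every admissible V1 torus (`k ≥ 2`, `M_h = Lᵃ ≥ 8`,
`M₂ ≤ L·M_h`, `R ≥ 2L²`, `P′ ≥ 5`, `L ≥ 5`, cubes placed, the Lemma-2.1 budget `N₀ + 1 ≤ R·L·M_h` and (2.59) at rate `σ`, `c′ ≠ 0`, weights in the band),
writing `Nbig = 3·9^{d+1}` and `K = K261 N₀ (d+1) L 1 (ασ)`, there is `θ ≥ 0` with `θ·(2K) < 1` and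
(i) `G = G₀ + G·R`; (i′) `G = Σ_{n<N} G₀Rⁿ + G·R^N` for every `N`; (ii) (2.135) `|R(x,x′)| ≤ θ·e^{−σ d_T(y,y′)}` blockwise; (iii)
`|G₀(x,x′)| ≤ (Nbig·C_G)·(L^{j(y)}/c′)²·e^{−σ d_T(y,y′)}`; (iv) for every `N`: `|(G·R^N)(x,x′)| ≤ 2·(Nbig·C_G)·K·(½)^N·(L^{j(y)}/c′)²·e^{−delta3 α (2σ)·d_T(y,y′)}` —
the series (2.141) converges to `G` GEOMETRICALLY in the norm of (2.136)₁ (whose majorant of record, `B6Line3CubeV1.prop26_2136_kLevel_unconditional`, has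
the same shape `A·(L^{j(y)}/c′)²·e^{−δ₃d_T}`), uniformly in `k, M_h, m, K, c′`.  Inputs BY NAME: the (2.134) family and its located smallness
`Nbig²θ₀(2K) < 1` = p22's `B6Ineq2134KFamKLevelExportV1.h2134_kFam_kLevel_unconditional`; (2.133) = r03's `B6CubeInDecayV1.hGin_cube`; (hagree)∕(hinvl) =
r03's `B6CubeWindowV1.hagree_cube`∕`hinvl_cube`; `OutLoc (M_□h_□) □̃` = p38's `B6CubeMoutV1.outLoc_Ml_hB'`; `Nbig` = r03's
`B6Cover236QbigOverlapV1.card_filter_mem_QbigT_le`.  HONEST SCOPE: the norm of (2.136)₁ only (the other norms of the sentence are not claimed here);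
`L ≥ 5`; constants on `d, L, b₀, b₁` (+ `α, N₀` through `K`); integer torus, lattice units; NOT a discharge, count-neutral.
[cite: Balaban1984PropagatorsII, Prop. 2.6 (2.141) p.247 («the series above is convergent in the norms appearing in the inequalities (2.136)–(2.140)»), (2.133)–(2.136) p.247, (2.91)–(2.93) p.239, Lemma 2.1 p.234] -/
theorem series2141_kLevel_unconditional (d ℓ : ℕ) (hd : 1 ≤ d + 1) (hL : Odd (ℓ + 1) ∧ 1 < ℓ + 1) {b₀ b₁ : ℝ} (hb₀ : 0 < b₀) (hb₁ : b₀ ≤ b₁) :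
    ∃ σ₁ : ℝ, 0 < σ₁ ∧ ∃ CG : ℝ, 0 ≤ CG ∧ ∀ (σ : ℝ), 0 < σ → σ ≤ σ₁ → ∀ (α : ℝ), 0 ≤ α → α ≤ 1 → ∀ (N₀ : ℕ), 0 < N₀ →
    ∃ M₂ : ℝ, 0 < M₂ ∧
    ∀ (m K : ℕ) {Mh k R : ℕ} {P' : Fin (d + 1) → ℕ}
      (hN : ∀ μ, N0 ℓ Mh k P' μ = (PV d ℓ m K hd hL).sitesPerDir 0) (D : TDomains d ℓ Mh k P' R) (hk : k ≤ m + K) (_ : 2 ≤ k)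
      {a : ℕ} (hMha : Mh = (ℓ + 1) ^ a) (hM8 : 8 ≤ Mh) (_ : 2 * (ℓ + 1) ^ 2 ≤ R) (hP5 : ∀ μ, 5 ≤ P' μ) (_ : 4 ≤ ℓ)
      (hpl : ∀ c : ↥(cubes D.toDomains), Placed ℓ k P' c.1)
      (_ : M₂ ≤ ((ℓ : ℝ) + 1) * Mh) (_ : N₀ + 1 ≤ R * ((ℓ + 1) * Mh))
      (_ : Real.exp (-(α * σ)) * ((ℓ : ℝ) + 1) ^ ((2 * (d + 1 : ℕ) : ℝ) / N₀) < 1)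
      {cf : ℝ} (hcf : cf ≠ 0) {w : BondIdx (domT hN D hk) → ℝ} (hw : ∀ i, 0 < w i) (_ : GlobalBand b₀ b₁ cf w),
      ∃ θ : ℝ, 0 ≤ θ ∧ θ * (2 * K261 N₀ (d + 1) ((ℓ : ℝ) + 1) 1 (α * σ)) < 1 ∧
      -- (i) the fixed point `G = G₀ + G·R`
      onFun (GE (domT hN D hk) hcf hw) =
        gZero Finset.univ (fun c => mulOp (hB hN D c))
            (fun c => Gl hN hk (one_le_of_eight_le hM8) (four_le_of_five_le hP5) hMha c (band_le (d := d) (ℓ := ℓ) hb₀ hb₁) (hpl c) w cf) +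
          onFun (GE (domT hN D hk) hcf hw) *
            rOp Finset.univ (onFun (dE (P := PV d ℓ m K hd hL) cf ∘ₗ (LinearMap.id - RE (domT hN D hk) cf) ∘ₗ dsE cf))
              (fun c => mulOp (hB hN D c)) (fun c => mulOp (zB hN D (one_le_of_eight_le hM8) (four_le_of_five_le hP5) c))
              (fun c => Gl hN hk (one_le_of_eight_le hM8) (four_le_of_five_le hP5) hMha c (band_le (d := d) (ℓ := ℓ) hb₀ hb₁) (hpl c) w cf)
              (fun c => Ml hN hk (one_le_of_eight_le hM8) (four_le_of_five_le hP5) hMha c (band_le (d := d) (ℓ := ℓ) hb₀ hb₁) (hpl c) w cf)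
              (fun c => Pl hN hk (one_le_of_eight_le hM8) (four_le_of_five_le hP5) hMha c (band_le (d := d) (ℓ := ℓ) hb₀ hb₁) (hpl c) w cf) ∧
      -- (i′) the partial sums of (2.141)
      (∀ N : ℕ, onFun (GE (domT hN D hk) hcf hw) =
        (∑ n ∈ Finset.range N, gZero Finset.univ (fun c => mulOp (hB hN D c))
            (fun c => Gl hN hk (one_le_of_eight_le hM8) (four_le_of_five_le hP5) hMha c (band_le (d := d) (ℓ := ℓ) hb₀ hb₁) (hpl c) w cf) *
          rOp Finset.univ (onFun (dE (P := PV d ℓ m K hd hL) cf ∘ₗ (LinearMap.id - RE (domT hN D hk) cf) ∘ₗ dsE cf))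
              (fun c => mulOp (hB hN D c)) (fun c => mulOp (zB hN D (one_le_of_eight_le hM8) (four_le_of_five_le hP5) c))
              (fun c => Gl hN hk (one_le_of_eight_le hM8) (four_le_of_five_le hP5) hMha c (band_le (d := d) (ℓ := ℓ) hb₀ hb₁) (hpl c) w cf)
              (fun c => Ml hN hk (one_le_of_eight_le hM8) (four_le_of_five_le hP5) hMha c (band_le (d := d) (ℓ := ℓ) hb₀ hb₁) (hpl c) w cf)
              (fun c => Pl hN hk (one_le_of_eight_le hM8) (four_le_of_five_le hP5) hMha c (band_le (d := d) (ℓ := ℓ) hb₀ hb₁) (hpl c) w cf) ^ n) +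
        onFun (GE (domT hN D hk) hcf hw) *
          rOp Finset.univ (onFun (dE (P := PV d ℓ m K hd hL) cf ∘ₗ (LinearMap.id - RE (domT hN D hk) cf) ∘ₗ dsE cf))
              (fun c => mulOp (hB hN D c)) (fun c => mulOp (zB hN D (one_le_of_eight_le hM8) (four_le_of_five_le hP5) c))
              (fun c => Gl hN hk (one_le_of_eight_le hM8) (four_le_of_five_le hP5) hMha c (band_le (d := d) (ℓ := ℓ) hb₀ hb₁) (hpl c) w cf)
              (fun c => Ml hN hk (one_le_of_eight_le hM8) (four_le_of_five_le hP5) hMha c (band_le (d := d) (ℓ := ℓ) hb₀ hb₁) (hpl c) w cf)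
              (fun c => Pl hN hk (one_le_of_eight_le hM8) (four_le_of_five_le hP5) hMha c (band_le (d := d) (ℓ := ℓ) hb₀ hb₁) (hpl c) w cf) ^ N) ∧
      -- (ii) (2.135) for `R`
      HasMajorant (g := geomT D) (blkV1 hN D)
        (rOp Finset.univ (onFun (dE (P := PV d ℓ m K hd hL) cf ∘ₗ (LinearMap.id - RE (domT hN D hk) cf) ∘ₗ dsE cf))
            (fun c => mulOp (hB hN D c)) (fun c => mulOp (zB hN D (one_le_of_eight_le hM8) (four_le_of_five_le hP5) c))
            (fun c => Gl hN hk (one_le_of_eight_le hM8) (four_le_of_five_le hP5) hMha c (band_le (d := d) (ℓ := ℓ) hb₀ hb₁) (hpl c) w cf)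
            (fun c => Ml hN hk (one_le_of_eight_le hM8) (four_le_of_five_le hP5) hMha c (band_le (d := d) (ℓ := ℓ) hb₀ hb₁) (hpl c) w cf)
            (fun c => Pl hN hk (one_le_of_eight_le hM8) (four_le_of_five_le hP5) hMha c (band_le (d := d) (ℓ := ℓ) hb₀ hb₁) (hpl c) w cf))
        (fun y y' => θ * Real.exp (-(σ * (geomT D).dist y y'))) ∧
      -- (iii) the first term `G₀`
      HasMajorant (g := geomT D) (blkV1 hN D)
        (gZero Finset.univ (fun c => mulOp (hB hN D c))
            (fun c => Gl hN hk (one_le_of_eight_le hM8) (four_le_of_five_le hP5) hMha c (band_le (d := d) (ℓ := ℓ) hb₀ hb₁) (hpl c) w cf))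
        (fun y y' => (((3 * 9 ^ (d + 1) : ℕ) : ℝ) * CG) * pref cf y * Real.exp (-(σ * (geomT D).dist y y'))) ∧
      -- (iv) the remainders `G·R^N`
      ∀ N : ℕ, HasMajorant (g := geomT D) (blkV1 hN D)
        (onFun (GE (domT hN D hk) hcf hw) *
          rOp Finset.univ (onFun (dE (P := PV d ℓ m K hd hL) cf ∘ₗ (LinearMap.id - RE (domT hN D hk) cf) ∘ₗ dsE cf))
              (fun c => mulOp (hB hN D c)) (fun c => mulOp (zB hN D (one_le_of_eight_le hM8) (four_le_of_five_le hP5) c))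
              (fun c => Gl hN hk (one_le_of_eight_le hM8) (four_le_of_five_le hP5) hMha c (band_le (d := d) (ℓ := ℓ) hb₀ hb₁) (hpl c) w cf)
              (fun c => Ml hN hk (one_le_of_eight_le hM8) (four_le_of_five_le hP5) hMha c (band_le (d := d) (ℓ := ℓ) hb₀ hb₁) (hpl c) w cf)
              (fun c => Pl hN hk (one_le_of_eight_le hM8) (four_le_of_five_le hP5) hMha c (band_le (d := d) (ℓ := ℓ) hb₀ hb₁) (hpl c) w cf) ^ N)
        (fun y y' => 2 * ((((3 * 9 ^ (d + 1) : ℕ) : ℝ) * CG) * K261 N₀ (d + 1) ((ℓ : ℝ) + 1) 1 (α * σ)) * (1 / 2) ^ N * pref cf y *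
          Real.exp (-(delta3 α (2 * σ) * (geomT D).dist y y'))) := by
  have ha₀ : (0 : ℝ) < b₀ / ((ℓ + 1 : ℕ) : ℝ) := by positivity
  obtain ⟨ρG, hρG, CG, hCG, hGin⟩ := hGin_cube d ℓ hd hL ha₀ (band_le (d := d) (ℓ := ℓ) hb₀ hb₁)
  obtain ⟨σ₀, hσ₀, hJ⟩ := h2134_kFam_kLevel_unconditional d ℓ hd hL hb₀ hb₁
  refine ⟨min ρG σ₀, lt_min hρG hσ₀, CG, hCG, fun σ hσ hσ1 α hα0 hα1 N₀ hN₀ => ?_⟩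
  obtain ⟨M₂, hM₂, hJ2⟩ := hJ σ hσ (hσ1.trans (min_le_right _ _)) α hα0 N₀ hN₀ (3 * 9 ^ (d + 1))
  refine ⟨M₂, hM₂, ?_⟩
  intro m K Mh k R P' hN D hk hk2 a hMha hM8 hR2 hP5 hℓ hpl hM hRM hθ cf hcf w hw hwb
  have hMh1 : 1 ≤ Mh := one_le_of_eight_le hM8
  have hP4 : ∀ μ, 4 ≤ P' μ := four_le_of_five_le hP5
  have hMh : 2 ≤ Mh := le_trans (by norm_num) hM8
  have hR : 2 * (ℓ + 1) ≤ R := le_trans (by nlinarith : 2 * (ℓ + 1) ≤ 2 * (ℓ + 1) ^ 2) hR2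
  have hdnn : ∀ y y' : (geomT D).Site, 0 ≤ (geomT D).dist y y' := fun _ _ => Nat.cast_nonneg _
  obtain ⟨θ₀, hθ₀, hsm0, hfam⟩ := hJ2 m K hN D hk hk2 hMha hM8 hR2 hP5 hℓ hpl hM hcf w
  have hK0 : 0 ≤ K261 N₀ (d + 1) ((ℓ : ℝ) + 1) 1 (α * σ) := K261_nonneg (by positivity) zero_le_one
  have hNb : (0 : ℝ) ≤ ((3 * 9 ^ (d + 1) : ℕ) : ℝ) := Nat.cast_nonneg _
  have hsm : (((3 * 9 ^ (d + 1) : ℕ) : ℝ)) ^ 2 * θ₀ * K261 N₀ (d + 1) ((ℓ : ℝ) + 1) 1 (α * σ) < 1 := small_of_small_two hθ₀ hsm0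
  have hhalf : 2 * σ / 2 = σ := by ring
  -- (2.133) for the genuine members at the rate `σ ≤ ρ_G`
  have h2133 : ∀ c : ↥(cubes D.toDomains), LocalMajorant (g := geomT D) (blkV1 hN D)
      (Gl hN hk hMh1 hP4 hMha c (band_le (d := d) (ℓ := ℓ) hb₀ hb₁) (hpl c) w cf) (ST D hMh1 hP4 c)
      (fun y y' => CG * pref cf y * Real.exp (-((2 * σ) / 2 * (geomT D).dist y y'))) := by
    intro c
    refine (inMajorant_mono _ (hGin m K hN D hk hMh1 hP4 hMha hMh hR2 hℓ c (hpl c) w cf) fun y y' _ => ?_).localMajorant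
    rw [hhalf]
    have := pref_nonneg cf y
    exact mul_le_mul_of_nonneg_left (exp_le_exp_of_rate (hσ1.trans (min_le_left _ _)) (hdnn y y')) (by positivity)
  -- the skeleton on the genuine members
  obtain ⟨hfix, hRm, hG0m, htail⟩ := series2141_kLevel_skeleton₂ hN D hk hMh hR hP5 hσ hCG α hα0 hα1 N₀ hN₀ hRM hθ hcf hw
    (3 * 9 ^ (d + 1)) (hNov_SbigT_of_QbigT D hMh1 hP4 (fun y => card_filter_mem_QbigT_le D hL hMh hR2 hMh1 hP4 y))
    (fun c => Gl hN hk hMh1 hP4 hMha c (band_le (d := d) (ℓ := ℓ) hb₀ hb₁) (hpl c) w cf)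
    (fun c => Ml hN hk hMh1 hP4 hMha c (band_le (d := d) (ℓ := ℓ) hb₀ hb₁) (hpl c) w cf)
    (fun c => Pl hN hk hMh1 hP4 hMha c (band_le (d := d) (ℓ := ℓ) hb₀ hb₁) (hpl c) w cf) h2133
    (fun c => hagree_cube hN hk hMh1 hP4 hMha c (band_le (d := d) (ℓ := ℓ) hb₀ hb₁) hk2 hM8 hR2 (hpl c) w hcf
      (fun i hi _ => band_of_global hN hk hMh1 hP4 c (le_of_lt hb₀) hcf w hwb i hi))
    (fun c => hinvl_cube hN hk hMh1 hP4 hMha c (band_le (d := d) (ℓ := ℓ) hb₀ hb₁) ha₀ hM8 hR2 (hpl c) w hcf)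
    (fun c => outLoc_Ml_hB' hN hk hMh1 hP4 hMha c (band_le (d := d) (ℓ := ℓ) hb₀ hb₁) hM8 hR2 hP5 (hpl c) w cf)
    θ₀ hθ₀ (fun c c' => hasMajorant_mono (g := geomT D) _ (hfam c c') fun y y' => le_of_eq (by rw [hhalf])) hsm
  refine ⟨(((3 * 9 ^ (d + 1) : ℕ) : ℝ)) ^ 2 * θ₀, by positivity, by linarith [hsm0], hfix, fun N => fixedPoint_telescope hfix N, hRm, hG0m,
    fun N => ?_⟩
  refine hasMajorant_mono (g := geomT D) _ (htail N) fun y y' => ?_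
  have hq0 : 0 ≤ (((3 * 9 ^ (d + 1) : ℕ) : ℝ)) ^ 2 * θ₀ * K261 N₀ (d + 1) ((ℓ : ℝ) + 1) 1 (α * σ) := by positivity
  have hq2 : (((3 * 9 ^ (d + 1) : ℕ) : ℝ)) ^ 2 * θ₀ * K261 N₀ (d + 1) ((ℓ : ℝ) + 1) 1 (α * σ) * 2 < 1 := by nlinarith [hsm0]
  have hg := geom_tail_le hq0 hq2 N
  have hP := pref_nonneg cf y
  have hE := Real.exp_nonneg (-(delta3 α (2 * σ) * (geomT D).dist y y'))
  have hA0 : 0 ≤ (((3 * 9 ^ (d + 1) : ℕ) : ℝ) * CG) * K261 N₀ (d + 1) ((ℓ : ℝ) + 1) 1 (α * σ) := by positivity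
  calc (((3 * 9 ^ (d + 1) : ℕ) : ℝ) * CG) * K261 N₀ (d + 1) ((ℓ : ℝ) + 1) 1 (α * σ) *
        ((((3 * 9 ^ (d + 1) : ℕ) : ℝ)) ^ 2 * θ₀ * K261 N₀ (d + 1) ((ℓ : ℝ) + 1) 1 (α * σ)) ^ N *
        (1 - (((3 * 9 ^ (d + 1) : ℕ) : ℝ)) ^ 2 * θ₀ * K261 N₀ (d + 1) ((ℓ : ℝ) + 1) 1 (α * σ))⁻¹ * pref cf y *
        Real.exp (-(delta3 α (2 * σ) * (geomT D).dist y y'))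
      = (((3 * 9 ^ (d + 1) : ℕ) : ℝ) * CG) * K261 N₀ (d + 1) ((ℓ : ℝ) + 1) 1 (α * σ) *
        (((((3 * 9 ^ (d + 1) : ℕ) : ℝ)) ^ 2 * θ₀ * K261 N₀ (d + 1) ((ℓ : ℝ) + 1) 1 (α * σ)) ^ N *
          (1 - (((3 * 9 ^ (d + 1) : ℕ) : ℝ)) ^ 2 * θ₀ * K261 N₀ (d + 1) ((ℓ : ℝ) + 1) 1 (α * σ))⁻¹) *
        (pref cf y * Real.exp (-(delta3 α (2 * σ) * (geomT D).dist y y'))) := by ring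
    _ ≤ (((3 * 9 ^ (d + 1) : ℕ) : ℝ) * CG) * K261 N₀ (d + 1) ((ℓ : ℝ) + 1) 1 (α * σ) * (2 * (1 / 2) ^ N) *
        (pref cf y * Real.exp (-(delta3 α (2 * σ) * (geomT D).dist y y'))) :=
        mul_le_mul_of_nonneg_right (mul_le_mul_of_nonneg_left hg hA0) (mul_nonneg hP hE)
    _ = _ := by ring

/-- **THE (2.141) CLAUSE AT `L = 5`, `P′_μ ≥ 12`: THE PLACEMENT DISCHARGED** (the canonical index-`2` chart places every cube,
`B6CubeWindowV1.placed_all_cubes`) — `series2141_kLevel_unconditional` at `ℓ = 4` with only print's setting left as hypotheses ((2.2) `M` large,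
`R ≥ 2L²`; (2.16) the weight band; the V1 torus with `k ≥ 2`, `P′ ≥ 12`; the Lemma-2.1 budget).  Stated as: for every `N`, the remainder of the series
(2.141) after `N` terms has the majorant `A·(½)^N·(L^{j(y)}/c′)²·e^{−δ₃ d_T}` with ONE constant `A` (the partial-sum identity and the majorants of `R`, `G₀`
are in `series2141_kLevel_unconditional`). [cite: Balaban1984PropagatorsII, Prop. 2.6 (2.141) p.247, (2.2) p.224, (2.16) p.225] -/
theorem series2141_kLevel_remainder_L5 (d : ℕ) (hd : 1 ≤ d + 1) (hL : Odd (4 + 1) ∧ 1 < 4 + 1) {b₀ b₁ : ℝ} (hb₀ : 0 < b₀) (hb₁ : b₀ ≤ b₁) :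
    ∃ σ₁ : ℝ, 0 < σ₁ ∧ ∀ (σ : ℝ), 0 < σ → σ ≤ σ₁ → ∀ (α : ℝ), 0 ≤ α → α ≤ 1 → ∀ (N₀ : ℕ), 0 < N₀ →
    ∃ A M₂ : ℝ, 0 ≤ A ∧ 0 < M₂ ∧
    ∀ (m K : ℕ) {Mh k R : ℕ} {P' : Fin (d + 1) → ℕ}
      (hN : ∀ μ, N0 4 Mh k P' μ = (PV d 4 m K hd hL).sitesPerDir 0) (D : TDomains d 4 Mh k P' R) (hk : k ≤ m + K) (_ : 2 ≤ k)
      {a : ℕ} (hMha : Mh = (4 + 1) ^ a) (hM8 : 8 ≤ Mh) (_ : 2 * (4 + 1) ^ 2 ≤ R) (hP12 : ∀ μ, 12 ≤ P' μ)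
      (_ : M₂ ≤ (((4 : ℕ) : ℝ) + 1) * Mh) (_ : N₀ + 1 ≤ R * ((4 + 1) * Mh))
      (_ : Real.exp (-(α * σ)) * (((4 : ℕ) : ℝ) + 1) ^ ((2 * (d + 1 : ℕ) : ℝ) / N₀) < 1)
      {cf : ℝ} (hcf : cf ≠ 0) {w : BondIdx (domT hN D hk) → ℝ} (hw : ∀ i, 0 < w i) (_ : GlobalBand b₀ b₁ cf w) (N : ℕ),
      HasMajorant (g := geomT D) (blkV1 hN D)
        (onFun (GE (domT hN D hk) hcf hw) *
          rOp Finset.univ (onFun (dE (P := PV d 4 m K hd hL) cf ∘ₗ (LinearMap.id - RE (domT hN D hk) cf) ∘ₗ dsE cf))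
              (fun c => mulOp (hB hN D c))
              (fun c => mulOp (zB hN D (one_le_of_eight_le hM8) (four_le_of_five_le fun μ => le_trans (by norm_num) (hP12 μ)) c))
              (fun c => Gl hN hk (one_le_of_eight_le hM8) (four_le_of_five_le fun μ => le_trans (by norm_num) (hP12 μ)) hMha c
                (band_le (d := d) (ℓ := 4) hb₀ hb₁) (B6CubeWindowV1.placed_all_cubes rfl hP12 c) w cf)
              (fun c => Ml hN hk (one_le_of_eight_le hM8) (four_le_of_five_le fun μ => le_trans (by norm_num) (hP12 μ)) hMha c
                (band_le (d := d) (ℓ := 4) hb₀ hb₁) (B6CubeWindowV1.placed_all_cubes rfl hP12 c) w cf)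
              (fun c => Pl hN hk (one_le_of_eight_le hM8) (four_le_of_five_le fun μ => le_trans (by norm_num) (hP12 μ)) hMha c
                (band_le (d := d) (ℓ := 4) hb₀ hb₁) (B6CubeWindowV1.placed_all_cubes rfl hP12 c) w cf) ^ N)
        (fun y y' => A * (1 / 2) ^ N * pref cf y * Real.exp (-(delta3 α (2 * σ) * (geomT D).dist y y'))) := by
  obtain ⟨σ₁, hσ₁, CG, hCG, h⟩ := series2141_kLevel_unconditional d 4 hd hL hb₀ hb₁
  refine ⟨σ₁, hσ₁, fun σ hσ hσ1 α hα0 hα1 N₀ hN₀ => ?_⟩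
  obtain ⟨M₂, hM₂, h2⟩ := h σ hσ hσ1 α hα0 hα1 N₀ hN₀
  have hK0 : 0 ≤ K261 N₀ (d + 1) (((4 : ℕ) : ℝ) + 1) 1 (α * σ) := K261_nonneg (by positivity) zero_le_one
  refine ⟨2 * ((((3 * 9 ^ (d + 1) : ℕ) : ℝ) * CG) * K261 N₀ (d + 1) (((4 : ℕ) : ℝ) + 1) 1 (α * σ)), M₂, by positivity, hM₂, ?_⟩
  intro m K Mh k R P' hN D hk hk2 a hMha hM8 hR2 hP12 hM hRM hθ cf hcf w hw hwb N
  obtain ⟨θ, -, -, -, -, -, -, htail⟩ := h2 m K hN D hk hk2 hMha hM8 hR2 (fun μ => le_trans (by norm_num) (hP12 μ)) le_rfl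
    (B6CubeWindowV1.placed_all_cubes rfl hP12) hM hRM hθ hcf hw hwb
  exact htail N

end Unconditional

/-! ## §4  (v1.1) LEFT FACTORS: the remainders of `DG = Σ_n (DG₀)Rⁿ` for every left factor `D` — the columns `Lʲη`, `·`, `1` of (2.136) and (2.137) -/

section LeftFactor

variable {g : B6.Geometry} {X : Type}

/-- **THE TAIL OF THE WALK FOR A LEFT FACTOR, generic**: if `G = G₀ + G·R` then `DG = DG₀ + (DG)R` for every left factor `D`; with majorants
`A′P′(y)e^{−δ₀d}` of `DG₀` and `θe^{−δ₀d}` of `R`, (2.61)/(2.63) with constant `c` and `θc < 1`, the remainder `(DG)R^N` of the series `DG = Σ_n (DG₀)Rⁿ` has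
the majorant `A′c(θc)^N(1 − θc)⁻¹P′(y)e^{−(1−α)δ₀d}` — p21's `majorant_remainder_266W` at `G′ := DG` (print: «reasoning in the same way as in the proof of
Proposition 2.2» for the columns `Lʲη`, `·`, `1` of the table in (2.136) and for (2.137)). [cite: Balaban1984PropagatorsII, Prop. 2.6 (2.136)–(2.137), (2.141) p.247; (2.65)–(2.66) p.234] -/
theorem leftFactor_remainder_tail [Fintype X] [DecidableEq X] (blk : X → g.Site) (c δ₀ α θ A' : ℝ)
    (P' : g.Site → ℝ) (hA' : 0 ≤ A') (hP' : ∀ y, 0 ≤ P' y) (hθ : 0 ≤ θ) (hc : 0 ≤ c) (hαδ : 0 ≤ (1 - α) * δ₀)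
    (htri : Triangle254 g) (hrefl : ∀ y : g.Site, g.dist y y = 0) (hdnn : ∀ y y' : g.Site, 0 ≤ g.dist y y')
    (h261 : Ineq261With c g δ₀ α) (h263 : Ineq263With c g δ₀ α) (hsmall : θ * c < 1)
    {G G0 R : Module.End ℝ (X → ℝ)} (Dop : Module.End ℝ (X → ℝ)) (hfix : G = G0 + G * R)
    (hDG0 : HasMajorant blk (Dop * G0) (fun a b => A' * P' a * Real.exp (-(δ₀ * g.dist a b))))
    (hR : HasMajorant blk R (fun a b => θ * Real.exp (-(δ₀ * g.dist a b)))) (N : ℕ) :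
    HasMajorant blk (Dop * G * R ^ N)
      (fun a b => A' * c * (θ * c) ^ N * (1 - θ * c)⁻¹ * P' a * Real.exp (-((1 - α) * δ₀ * g.dist a b))) := by
  have hfix' : Dop * G = Dop * G0 + Dop * G * R := by
    conv_lhs => rw [hfix]
    rw [mul_add, mul_assoc]
  exact majorant_remainder_266W blk c δ₀ α θ A' P' hA' hP' hθ hc hαδ htri hrefl hdnn h261 h263 hsmall hDG0 hR hfix' N

end LeftFactor

section LeftFactorKLevel

open B6Prop26Gluing (ind hasMajorant_sum_overlap)

variable {d ℓ : ℕ} {hd : 1 ≤ d + 1} {hL : Odd (ℓ + 1) ∧ 1 < ℓ + 1} {m K : ℕ} {Mh k R : ℕ} {P' : Fin (d + 1) → ℕ}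

open Classical in
/-- **THE LEFT-FACTOR COLUMNS OF THE (2.141) SENTENCE AT k LEVELS — NO DISPLAYED ANALYTIC INPUT BEYOND THE FIRST LEGS.**  Under the binders of
`series2141_kLevel_unconditional` (same `σ₁`, same threshold `M₂`): for every left factor `D`, constant `A′ ≥ 0` and weight `P′ ≥ 0`, IF every cube's first
leg `D·(h_□G_□h_□)` has the majorant `1_{□̃}(y)·A′P′(y)·e^{−σd_T}` (the displayed hypothesis of p38's left-factor clause
`B6Prop26LeftEntryKLevelV1.prop26_pair_of_2133_2134With₂`, discharged in the tree for `D = ∇_ν` / `Δ` / the Hölder quotients by the per-cube leg files), THEN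
for every `N` the remainder of `DG = Σ_n (DG₀)Rⁿ` after `N` terms satisfies
`|((DG)R^N)(x,x′)| ≤ 2·(Nbig·A′)·K·(½)^N·P′(y)·e^{−delta3 α (2σ)·d_T(y,y′)}` (`Nbig = 3·9^{d+1}`, `K = K261 N₀ (d+1) L 1 (ασ)`) — the series (2.141) multiplied
by a left factor converges geometrically in the block-majorant norm with the weight `P′` of that column of (2.136)/(2.137).  Proof: `DG₀` glued from the legs by
r03's `hasMajorant_sum_overlap` with the overlap number of the `□̃` (`card_filter_mem_QbigT_le`), the fixed point and (2.135) from `series2141_kLevel_unconditional`,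
Lemma 2.1 on the torus (`lemma21_torus`), the generic tail `leftFactor_remainder_tail`.  HONEST SCOPE: the first legs stay DISPLAYED (their producers are the
per-entry files of the (2.136)₂₋₄/(2.137) slots); count-neutral. [cite: Balaban1984PropagatorsII, Prop. 2.6 (2.136)–(2.137), (2.141) p.247, (2.133)–(2.135) p.247, Lemma 2.1 p.234] -/
theorem series2141_leftFactor_kLevel_unconditional (d ℓ : ℕ) (hd : 1 ≤ d + 1) (hL : Odd (ℓ + 1) ∧ 1 < ℓ + 1) {b₀ b₁ : ℝ} (hb₀ : 0 < b₀) (hb₁ : b₀ ≤ b₁) :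
    ∃ σ₁ : ℝ, 0 < σ₁ ∧ ∀ (σ : ℝ), 0 < σ → σ ≤ σ₁ → ∀ (α : ℝ), 0 ≤ α → α ≤ 1 → ∀ (N₀ : ℕ), 0 < N₀ →
    ∃ M₂ : ℝ, 0 < M₂ ∧
    ∀ (m K : ℕ) {Mh k R : ℕ} {P' : Fin (d + 1) → ℕ}
      (hN : ∀ μ, N0 ℓ Mh k P' μ = (PV d ℓ m K hd hL).sitesPerDir 0) (D : TDomains d ℓ Mh k P' R) (hk : k ≤ m + K) (_ : 2 ≤ k)
      {a : ℕ} (hMha : Mh = (ℓ + 1) ^ a) (hM8 : 8 ≤ Mh) (_ : 2 * (ℓ + 1) ^ 2 ≤ R) (hP5 : ∀ μ, 5 ≤ P' μ) (_ : 4 ≤ ℓ)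
      (hpl : ∀ c : ↥(cubes D.toDomains), Placed ℓ k P' c.1)
      (_ : M₂ ≤ ((ℓ : ℝ) + 1) * Mh) (_ : N₀ + 1 ≤ R * ((ℓ + 1) * Mh))
      (_ : Real.exp (-(α * σ)) * ((ℓ : ℝ) + 1) ^ ((2 * (d + 1 : ℕ) : ℝ) / N₀) < 1)
      {cf : ℝ} (hcf : cf ≠ 0) {w : BondIdx (domT hN D hk) → ℝ} (hw : ∀ i, 0 < w i) (_ : GlobalBand b₀ b₁ cf w)
      -- the left factor and its displayed first legs
      (Dop : Module.End ℝ (PBond (PV d ℓ m K hd hL) 0 → ℝ)) (A' : ℝ) (Pw : (geomT D).Site → ℝ) (_ : 0 ≤ A') (_ : ∀ y, 0 ≤ Pw y)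
      (_ : ∀ c : ↥(cubes D.toDomains), HasMajorant (g := geomT D) (blkV1 hN D)
        (Dop * (mulOp (hB hN D c) *
          Gl hN hk (one_le_of_eight_le hM8) (four_le_of_five_le hP5) hMha c (band_le (d := d) (ℓ := ℓ) hb₀ hb₁) (hpl c) w cf * mulOp (hB hN D c)))
        (fun y y' => ind (SbigT D (one_le_of_eight_le hM8) (four_le_of_five_le hP5) c) y * (A' * Pw y * Real.exp (-(σ * (geomT D).dist y y')))))
      (N : ℕ),
      HasMajorant (g := geomT D) (blkV1 hN D)
        (Dop * onFun (GE (domT hN D hk) hcf hw) *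
          rOp Finset.univ (onFun (dE (P := PV d ℓ m K hd hL) cf ∘ₗ (LinearMap.id - RE (domT hN D hk) cf) ∘ₗ dsE cf))
              (fun c => mulOp (hB hN D c)) (fun c => mulOp (zB hN D (one_le_of_eight_le hM8) (four_le_of_five_le hP5) c))
              (fun c => Gl hN hk (one_le_of_eight_le hM8) (four_le_of_five_le hP5) hMha c (band_le (d := d) (ℓ := ℓ) hb₀ hb₁) (hpl c) w cf)
              (fun c => Ml hN hk (one_le_of_eight_le hM8) (four_le_of_five_le hP5) hMha c (band_le (d := d) (ℓ := ℓ) hb₀ hb₁) (hpl c) w cf)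
              (fun c => Pl hN hk (one_le_of_eight_le hM8) (four_le_of_five_le hP5) hMha c (band_le (d := d) (ℓ := ℓ) hb₀ hb₁) (hpl c) w cf) ^ N)
        (fun y y' => 2 * ((((3 * 9 ^ (d + 1) : ℕ) : ℝ) * A') * K261 N₀ (d + 1) ((ℓ : ℝ) + 1) 1 (α * σ)) * (1 / 2) ^ N * Pw y *
          Real.exp (-(delta3 α (2 * σ) * (geomT D).dist y y'))) := by
  obtain ⟨σ₁, hσ₁, CG, -, h⟩ := series2141_kLevel_unconditional d ℓ hd hL hb₀ hb₁
  refine ⟨σ₁, hσ₁, fun σ hσ hσ1 α hα0 hα1 N₀ hN₀ => ?_⟩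
  obtain ⟨M₂, hM₂, h2⟩ := h σ hσ hσ1 α hα0 hα1 N₀ hN₀
  refine ⟨M₂, hM₂, ?_⟩
  intro m K Mh k R P' hN D hk hk2 a hMha hM8 hR2 hP5 hℓ hpl hM hRM hθ cf hcf w hw hwb Dop A' Pw hA' hPw hlegs N
  have hMh1 : 1 ≤ Mh := one_le_of_eight_le hM8
  have hP4 : ∀ μ, 4 ≤ P' μ := four_le_of_five_le hP5
  have hP : ∀ μ, 1 ≤ P' μ := one_le_of_four_le hP4
  have hMh : 2 ≤ Mh := le_trans (by norm_num) hM8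
  obtain ⟨θ, hθ0, hθK, hfix, -, hRm, -, -⟩ := h2 m K hN D hk hk2 hMha hM8 hR2 hP5 hℓ hpl hM hRM hθ hcf hw hwb
  obtain ⟨_, h261, _, h263⟩ := lemma21_torus D hMh1 hP hN₀ hRM hσ.le hα0 hα1 hθ
  obtain ⟨htri, hrefl, hdnn⟩ := triangle_refl_nonneg_T D hMh1 hP
  have hK0 : 0 ≤ K261 N₀ (d + 1) ((ℓ : ℝ) + 1) 1 (α * σ) := K261_nonneg (by positivity) zero_le_one
  have hNb : (0 : ℝ) ≤ ((3 * 9 ^ (d + 1) : ℕ) : ℝ) := Nat.cast_nonneg _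
  have hsmall : θ * K261 N₀ (d + 1) ((ℓ : ℝ) + 1) 1 (α * σ) < 1 := by nlinarith
  have hαδ : 0 ≤ (1 - α) * σ := mul_nonneg (by linarith) hσ.le
  -- the first term `DG₀`, glued over the `□̃`
  have hK' : ∀ a b : (geomT D).Site, 0 ≤ A' * Pw a * Real.exp (-(σ * (geomT D).dist a b)) := fun a b =>
    mul_nonneg (mul_nonneg hA' (hPw a)) (Real.exp_nonneg _)
  have hDG0 : HasMajorant (g := geomT D) (blkV1 hN D)
      (Dop * gZero Finset.univ (fun c => mulOp (hB hN D c))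
        (fun c => Gl hN hk (one_le_of_eight_le hM8) (four_le_of_five_le hP5) hMha c (band_le (d := d) (ℓ := ℓ) hb₀ hb₁) (hpl c) w cf))
      (fun a b => (((3 * 9 ^ (d + 1) : ℕ) : ℝ) * A') * Pw a * Real.exp (-(σ * (geomT D).dist a b))) := by
    unfold gZero
    rw [Finset.mul_sum]
    refine hasMajorant_mono (g := geomT D) _ (hasMajorant_sum_overlap (g := geomT D) (blkV1 hN D) Finset.univ
      (fun c => SbigT D (one_le_of_eight_le hM8) (four_le_of_five_le hP5) c) _ _ hK' (fun c _ => hlegs c) (3 * 9 ^ (d + 1))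
      (hNov_SbigT_of_QbigT D hMh1 hP4 fun y => card_filter_mem_QbigT_le D hL hMh hR2 hMh1 hP4 y)) fun a b => le_of_eq ?_
    push_cast
    ring
  have htail := leftFactor_remainder_tail (g := geomT D) (blkV1 hN D) (K261 N₀ (d + 1) ((ℓ : ℝ) + 1) 1 (α * σ)) σ α θ
    ((((3 * 9 ^ (d + 1) : ℕ) : ℝ)) * A') Pw (by positivity) hPw hθ0 hK0 hαδ htri hrefl hdnn h261 h263 hsmall Dop hfix hDG0 hRm N
  refine hasMajorant_mono (g := geomT D) _ htail fun y y' => ?_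
  have hq0 : 0 ≤ θ * K261 N₀ (d + 1) ((ℓ : ℝ) + 1) 1 (α * σ) := by positivity
  have hq2 : θ * K261 N₀ (d + 1) ((ℓ : ℝ) + 1) 1 (α * σ) * 2 < 1 := by nlinarith
  have hg := geom_tail_le hq0 hq2 N
  have hPy := hPw y
  have e3 : (1 - α) * σ = delta3 α (2 * σ) := by unfold delta3; ring
  rw [e3]
  have hE := Real.exp_nonneg (-(delta3 α (2 * σ) * (geomT D).dist y y'))
  have hA0 : 0 ≤ (((3 * 9 ^ (d + 1) : ℕ) : ℝ) * A') * K261 N₀ (d + 1) ((ℓ : ℝ) + 1) 1 (α * σ) := by positivity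
  calc (((3 * 9 ^ (d + 1) : ℕ) : ℝ) * A') * K261 N₀ (d + 1) ((ℓ : ℝ) + 1) 1 (α * σ) *
        (θ * K261 N₀ (d + 1) ((ℓ : ℝ) + 1) 1 (α * σ)) ^ N * (1 - θ * K261 N₀ (d + 1) ((ℓ : ℝ) + 1) 1 (α * σ))⁻¹ * Pw y *
        Real.exp (-(delta3 α (2 * σ) * (geomT D).dist y y'))
      = (((3 * 9 ^ (d + 1) : ℕ) : ℝ) * A') * K261 N₀ (d + 1) ((ℓ : ℝ) + 1) 1 (α * σ) *
        ((θ * K261 N₀ (d + 1) ((ℓ : ℝ) + 1) 1 (α * σ)) ^ N * (1 - θ * K261 N₀ (d + 1) ((ℓ : ℝ) + 1) 1 (α * σ))⁻¹) *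
        (Pw y * Real.exp (-(delta3 α (2 * σ) * (geomT D).dist y y'))) := by ring
    _ ≤ (((3 * 9 ^ (d + 1) : ℕ) : ℝ) * A') * K261 N₀ (d + 1) ((ℓ : ℝ) + 1) 1 (α * σ) * (2 * (1 / 2) ^ N) *
        (Pw y * Real.exp (-(delta3 α (2 * σ) * (geomT D).dist y y'))) :=
        mul_le_mul_of_nonneg_right (mul_le_mul_of_nonneg_left hg hA0) (mul_nonneg hPy hE)
    _ = _ := by ring

end LeftFactorKLevel

end

end Literature.MathematicalPhysics.QuantumFieldTheory.Balaban1983to89.B6Series2141KLevelV1
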